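import Literature.NumberTheory.Automorphic.UnitaryGroupDoubledSiegelGeneration
import Literature.NumberTheory.GelbartRogawski1991.DoubledUnitaryGlobalSplittingData
import HarnessLib

-- buildfix G11b-3 recipe (LEDGER B13-1/B13-3): elaborate sequentially so the trailing `attribute [implicit_reducible]`
-- block (reducibilityCoreExt is keyed to the async environment branch) is in force at `.olean` export.
set_option Elab.async false

/-!
# Rational clause of the doubled Weil representation, I: generation, adelic Schur, pinning, principal ideles

[GelbartRogawski1991, §3.1 Prop. 3.1.1 p. 455 L1–2, "`s(G(F)) ⊆ i(Sp_F(W))`"] by doubling, first half of the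
RATIONAL CLAUSE for the objects of `DoubledUnitaryGlobalSplittingData`:
* **S2** `S2_ratH_normalClosure_siegel`: `H(L⁺)` is contained in the closure of the `H(L⁺)`-conjugates of
  `P_Δ(L⁺)` (the tree's `DoubledUnitary.toAdelic_mem_closure_siegelConjugates`, `UnitaryGroupDoubledSiegelGeneration`);
* **S3a** adelic Schur `S3a_central_of_proj_eq_one`: an element of `Mp(𝕎^𝔻)ᶜᵒⁿᵗ` over `1 ∈ Sp` is central (its
  operator is a scalar: tensor stripping `exists_omega_eq_adelicTensorEnd_id_left` + finite Schur);
* the PINNING LEMMA `eq_of_proj_eq_of_evalZero_eq`: two elements over the same symplectic element with the same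
  non-vanishing value-at-0 functional are equal;
* **S3b** `toSpD_mem_range_ratSp`: `ι^𝔻(H(L⁺)) ⊆ Sp_{2(n+n)}(L⁺)`;
* **S3c** `chiDet_mul_modDelta_eq_one_of_rational`: on RATIONAL `P_Δ`-elements the prescribed scalar
  `χ(det_Δ p)|det_Δ p|^{1/2}` is `1` (`det_Δ p` is a principal idele; `χ|_{L^×} = 1`, product formula);
* **S3b-val** `rFD_mem_evalZeroFixing_of_mem_closure`: `r_F^𝔻` of words in rational Levi ∕ lower-unipotent
  generators fixes values at the origin (`coe_ratThetaLiftCont_levi ∕ _low`).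
-/

set_option autoImplicit false

noncomputable section

open scoped Classical
open scoped Matrix Kronecker TensorProduct
open NumberField IsDedekindDomain
open Literature.RepresentationTheory.HeisenbergGroup
open Literature.NumberTheory.Automorphic
open Literature.NumberTheory.Weil1964
open Literature.RepresentationTheory.HarrisKudlaSweet1996
open Literature.NumberTheory.GaloisRepresentations

namespace Literature.NumberTheory.GelbartRogawski1991.GRConstruction

open UnitaryDualPair

variable (L : Type) [Field L] [NumberField L] [IsCMField L]

variable {N M n : ℕ} (e : Fin N × Fin M ≃ Fin n)
  (dV : Fin N → L) (hdV : ∀ i, IsCMField.complexConj L (dV i) = dV i) (hdV0 : ∀ i, dV i ≠ 0)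
  (dW : Fin M → L) (hdW : ∀ i, IsCMField.complexConj L (dW i) = dW i) (hdW0 : ∀ i, dW i ≠ 0)

include hdV0 hdW0 in
/-- **S2 (the normal closure of `P_Δ(L⁺)` is `H(L⁺)`)**, on the tree's generic lemma
`DoubledUnitary.toAdelic_mem_closure_siegelConjugates` (`Literature/NumberTheory/Automorphic/UnitaryGroupDoubledSiegelGeneration.lean`).
[cite: GelbartRogawski1991, §3.1 Prop. 3.1.1 p. 455 L1–2] -/
theorem S2_ratH_normalClosure_siegel :
    ∀ γ ∈ ratH L e dV hdV dW hdW, γ ∈ Subgroup.closure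
      {x : HA L e dV hdV dW hdW | ∃ p ∈ ratH L e dV hdV dW hdW, ∃ h ∈ ratH L e dV hdV dW hdW,
        IsSiegelDelta L e dV hdV dW hdW p ∧ x = h * p * h⁻¹} := by
  rintro γ ⟨γ₀, rfl⟩
  set S : Matrix (Fin n) (Fin n) L := (gramR L e dV hdV dW hdW).map (algebraMap (Fp L) L) with hS
  have hJ : hermD L e dV hdV dW hdW = Matrix.reindex finSumFinEquiv finSumFinEquiv (Matrix.fromBlocks S 0 0 (-S)) := by
    rw [hermD, gramD, hS]
    ext i j
    simp only [Matrix.map_apply, Matrix.reindex_apply, Matrix.submatrix_apply]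
    rcases finSumFinEquiv.symm i with a | a <;> rcases finSumFinEquiv.symm j with b | b <;>
      simp [Matrix.fromBlocks, map_neg, map_zero]
  have hT : (gramR L e dV hdV dW hdW).IsSymm := by
    show (Matrix.reindex e e _).IsSymm
    exact (UnitaryGroup.isSymm_kronecker (realDiagonal_isSymm L dV hdV) (realDiagonal_isSymm L dW hdW)).submatrix _
  have hSσ : S.map (IsCMField.complexConj L : L →+* L) = S := by
    ext i j
    simp only [hS, Matrix.map_apply]
    exact (IsCMField.complexConj_eq_self_iff (K := L) _).2 (SetLike.coe_mem _)
  have hSs : Sᵀ = S := by rw [hS, ← Matrix.transpose_map, hT.eq]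
  have hSu : IsUnit S.det := by
    rw [hS, ← RingHom.mapMatrix_apply, ← RingHom.map_det]
    exact (isUnit_det_gram (Fp L) e (isUnit_det_realDiagonal L dV hdV hdV0) (isUnit_det_realDiagonal L dW hdW hdW0)).map _
  exact DoubledUnitary.toAdelic_mem_closure_siegelConjugates (Fp L) L (IsCMField.complexConj L)
    (fun x => IsCMField.complexConj_apply_apply L x) (complexConj_imagUnit L) (imagUnit_ne_zero L) finSumFinEquiv
    hSσ hSs hSu _ hJ γ₀

/-- ADELIC SCHUR, abstract packaging: in a group `M` of pairs-like elements with operator map `op : M →* (S ≃ₗ S)`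
and projection `π`, if every element over `1` acts by a scalar then it is central — provided `op` and `π` are
jointly injective. [cite: GelbartRogawski1991, §3.1 Prop. 3.1.1 p. 455 L1–2] -/
theorem central_of_scalar_abstract {M S Sp : Type*} [Group M] [Group Sp] [AddCommGroup S] [Module ℂ S]
    (π : M →* Sp) (op : M →* (S ≃ₗ[ℂ] S))
    (hinj : ∀ x y : M, π x = π y → op x = op y → x = y)
    (q : M) (hq : π q = 1) (c : ℂ) (hc : ∀ f : S, op q f = c • f) : q ∈ Subgroup.center M := by
  rw [Subgroup.mem_center_iff]
  intro g
  apply hinj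
  · rw [map_mul, map_mul, hq, mul_one, one_mul]
  · rw [map_mul, map_mul]
    apply LinearEquiv.ext
    intro f
    rw [LinearEquiv.mul_apply, LinearEquiv.mul_apply, hc, hc, map_smul]

include hdV0 hdW0 in
set_option maxHeartbeats 800000 in
/-- **ADELIC SCHUR (the analytic content of S3a and of the pinning lemma (r1))**: an element of `Mp(𝕎^𝔻)ᶜᵒⁿᵗ` over `1 ∈ Sp`
acts on `𝒮(𝔸^{n+n})` by a SCALAR — tensor stripping `exists_omega_eq_adelicTensorEnd_id_left` reduces to the finite factor, where
Schur for the finite Schrödinger module is the tree's `eq_smul_id_of_comm`.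
[cite: GelbartRogawski1991, §3.1 Prop. 3.1.1 p. 455 L1–2] -/
theorem exists_smul_of_proj_eq_one (q : MpD L e dV hdV dW hdW) (hq : projD L e dV hdV dW hdW q = 1) :
    ∃ c : ℂ, ∀ Φ : piSchwartzBruhat (Fp L) (Fin (n + n)),
      ((q : adelicMp (Fp L) (Fin (n + n)) (gramDA L e dV hdV dW hdW)) :
        symplecticGroup (polar (adelicForm (Fp L) (Fin (n + n)) (gramDA L e dV hdV dW hdW))) ×
          (piSchwartzBruhat (Fp L) (Fin (n + n)) ≃ₗ[ℂ] piSchwartzBruhat (Fp L) (Fin (n + n)))).2 Φ = c • Φ := by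
  have hTu : IsUnit (gramDA L e dV hdV dW hdW) :=
    (Matrix.isUnit_iff_isUnit_det _).2 (isUnit_det_gramDA L e dV hdV hdV0 dW hdW hdW0)
  have hTy : Function.Surjective fun y : Fin (n + n) → AdeleRing (𝓞 (Fp L)) (Fp L) => gramDA L e dV hdV dW hdW *ᵥ y :=
    (mulVec_bijective_of_isUnit hTu).2
  -- the symplectic component of `q` is `1`
  have hq0 : adelicMpCont.proj (Fp L) (Fin (n + n)) (gramDA L e dV hdV dW hdW) q = 1 := hq
  have hq1 : ((q : adelicMp (Fp L) (Fin (n + n)) (gramDA L e dV hdV dW hdW)) :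
      symplecticGroup (polar (adelicForm (Fp L) (Fin (n + n)) (gramDA L e dV hdV dW hdW))) ×
        (piSchwartzBruhat (Fp L) (Fin (n + n)) ≃ₗ[ℂ] piSchwartzBruhat (Fp L) (Fin (n + n)))).1 = 1 := by
    rw [adelicMpCont.proj_apply, MpPsi.proj_apply] at hq0
    exact hq0
  -- (1) the operator of `q` is `1 ⊗ B`
  have harch : ∀ a w : Fin (n + n) → mixedEmbedding.mixedSpace (Fp L),
      (adelicMpCont.proj (Fp L) (Fin (n + n)) (gramDA L e dV hdV dW hdW) q).1
        (archVec (Fp L) (Fin (n + n)) a, archVec (Fp L) (Fin (n + n)) w) =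
        (archVec (Fp L) (Fin (n + n)) a, archVec (Fp L) (Fin (n + n)) w) := by
    intro a w
    rw [hq0]
    rfl
  refine (exists_omega_eq_adelicTensorEnd_id_left hTu q harch).elim fun B hB => ?_
  have hB' : ∀ Φ : piSchwartzBruhat (Fp L) (Fin (n + n)),
      ((q : adelicMp (Fp L) (Fin (n + n)) (gramDA L e dV hdV dW hdW)) :
        symplecticGroup (polar (adelicForm (Fp L) (Fin (n + n)) (gramDA L e dV hdV dW hdW))) ×
          (piSchwartzBruhat (Fp L) (Fin (n + n)) ≃ₗ[ℂ] piSchwartzBruhat (Fp L) (Fin (n + n)))).2 Φ =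
        adelicTensorEnd LinearMap.id B Φ := by
    intro Φ
    have h2 := LinearMap.congr_fun hB Φ
    rw [adelicMpCont.omega_apply, omegaPsi_apply] at h2
    exact h2
  -- (2) `1 ⊗ B` implements the identity on the finite Heisenberg elements, hence `B` commutes with `ρ_f`
  have himp := (mem_MpPsi _ _).1 (q : adelicMp (Fp L) (Fin (n + n)) (gramDA L e dV hdV dW hdW)).2
  rw [hq1, map_one] at himp
  have hBimp : ∀ h ∈ finHeisenberg (gramDA L e dV hdV dW hdW), ∀ Φ : piSchwartzBruhat (Fp L) (Fin (n + n)),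
      adelicTensorEnd LinearMap.id B (adelicSchrodinger (Fp L) (Fin (n + n)) (gramDA L e dV hdV dW hdW) h Φ) =
        adelicSchrodinger (Fp L) (Fin (n + n)) (gramDA L e dV hdV dW hdW)
          ((1 : Heisenberg.PseudoSymplectic (polar (adelicForm (Fp L) (Fin (n + n)) (gramDA L e dV hdV dW hdW)))).act h)
          (adelicTensorEnd LinearMap.id B Φ) := by
    intro h _ Φ
    rw [← hB', ← hB']
    exact himp h Φ
  have hcomm : ∀ h ∈ finHeisenberg (gramDA L e dV hdV dW hdW),
      B ∘ₗ finSchrodinger (gramDA L e dV hdV dW hdW) h = finSchrodinger (gramDA L e dV hdV dW hdW) h ∘ₗ B := by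
    intro h hh
    have := comp_finSchrodinger_of_finImplementer hBimp hh
    rwa [Heisenberg.PseudoSymplectic.act_one] at this
  -- (3) Schur for the finite Schrödinger module
  have hCtr : ∀ (k : Fin (n + n) → FiniteAdeleRing (𝓞 (Fp L)) (Fp L)) (f : FinSB (Fp L) (Fin (n + n))),
      B (finTranslateSB (Fp L) (Fin (n + n)) k f) = finTranslateSB (Fp L) (Fin (n + n)) k (B f) := by
    intro k f
    have hc := LinearMap.congr_fun
      (hcomm _ (ofVec_mem_finHeisenberg (finIdem_smul_piAdeleSplit_zero k) (smul_zero _))) f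
    rw [finSchrodinger_ofVec_inl] at hc
    exact hc
  have hCmod : ∀ (y : Fin (n + n) → FiniteAdeleRing (𝓞 (Fp L)) (Fp L)) (f : FinSB (Fp L) (Fin (n + n))),
      B (finModulateSB (Fp L) (Fin (n + n)) y f) = finModulateSB (Fp L) (Fin (n + n)) y (B f) := by
    intro y f
    refine (exists_fin_mulVec_eq hTy y).elim fun y' hy' => ?_
    have hc := LinearMap.congr_fun (hcomm _ (ofVec_mem_finHeisenberg (smul_zero _) hy'.1)) f
    rw [finSchrodinger_ofVec_inr (gramDA L e dV hdV dW hdW) hy'.2] at hc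
    exact hc
  refine (eq_smul_id_of_comm B hCtr hCmod).elim fun c hc => ?_
  refine ⟨c, fun Φ => ?_⟩
  rw [hB', hc, adelicTensorEnd_smul_right, adelicTensorEnd_id]
  rfl

include hdV0 hdW0 in
/-- **S3a (ADELIC SCHUR ⇒ CENTRAL)**: an element of `Mp(𝕎^𝔻)ᶜᵒⁿᵗ` over `1 ∈ Sp` is CENTRAL.
[cite: GelbartRogawski1991, §3.1 Prop. 3.1.1 p. 455 L1–2] -/
theorem S3a_central_of_proj_eq_one (q : MpD L e dV hdV dW hdW) (hq : projD L e dV hdV dW hdW q = 1) :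
    q ∈ Subgroup.center (MpD L e dV hdV dW hdW) :=
  (exists_smul_of_proj_eq_one L e dV hdV hdV0 dW hdW hdW0 q hq).elim fun c hc =>
    central_of_scalar_abstract (projD L e dV hdV dW hdW)
      ((MpPsi.toOp _).comp (MpD L e dV hdV dW hdW).subtype)
      (fun x y h1 h2 => eq_of_proj_eq_of_op_eq L e dV hdV dW hdW x y h1 h2) q hq c hc

/-- ABSTRACT PINNING: over the same base point, two elements whose operators have the same value under a functional `ev`
that does not vanish identically on the first one's range coincide, when elements over `1` act by scalars.
[cite: GelbartRogawski1991, §3.1 Prop. 3.1.1 p. 455 L1–2] -/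
theorem pinned_abstract {M S Sp : Type*} [Group M] [Group Sp] [AddCommGroup S] [Module ℂ S]
    (π : M →* Sp) (op : M →* (S ≃ₗ[ℂ] S))
    (hinj : ∀ x y : M, π x = π y → op x = op y → x = y)
    (hschur : ∀ z : M, π z = 1 → ∃ c : ℂ, ∀ f, op z f = c • f)
    (ev : S →ₗ[ℂ] ℂ) (x y : M) (hπ : π x = π y) (hev : ∀ f, ev (op x f) = ev (op y f))
    (hne : ∃ f, ev (op x f) ≠ 0) : x = y := by
  obtain ⟨c, hc⟩ := hschur (y * x⁻¹) (by rw [map_mul, map_inv, hπ, mul_inv_cancel])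
  obtain ⟨f₀, hf₀⟩ := hne
  have hyx : ∀ f, op y f = c • op x f := fun f => by
    have := hc (op x f)
    rwa [map_mul, map_inv, LinearEquiv.mul_apply, LinearEquiv.coe_inv, LinearEquiv.symm_apply_apply] at this
  have hc1 : c = 1 := by
    have h := hev f₀
    rw [hyx, map_smul, smul_eq_mul] at h
    exact (mul_left_eq_self₀.1 h.symm).resolve_right hf₀
  refine hinj x y hπ (LinearEquiv.ext fun f => ?_)
  rw [hyx, hc1, one_smul]

include hdV0 hdW0 in
/-- **THE PINNING LEMMA — «an evaluation-form implementer is pinned by its value-at-0 scalar»**: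
two elements of `Mp(𝕎^𝔻)ᶜᵒⁿᵗ` over the SAME symplectic element whose operators have the same value-at-the-origin functional
`Φ ↦ (ω(·)Φ)(0)` — not identically zero for the first — are EQUAL.  (This is exactly what makes the parabolic prescription of
`IsDoubledWeilRep` ∕ `ParabolicNormalisedAt` a NORMALISATION and the existence stubs rigid; used in S3 and S1asm.)
[cite: GelbartRogawski1991, §3.1 Prop. 3.1.1 p. 455 L1–2] -/
theorem eq_of_proj_eq_of_evalZero_eq (x y : MpD L e dV hdV dW hdW)
    (hπ : projD L e dV hdV dW hdW x = projD L e dV hdV dW hdW y)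
    (hev : ∀ Φ : piSchwartzBruhat (Fp L) (Fin (n + n)), opD L e dV hdV dW hdW x Φ 0 = opD L e dV hdV dW hdW y Φ 0)
    (hne : ∃ Φ : piSchwartzBruhat (Fp L) (Fin (n + n)), opD L e dV hdV dW hdW x Φ 0 ≠ 0) : x = y :=
  pinned_abstract (projD L e dV hdV dW hdW) ((MpPsi.toOp _).comp (MpD L e dV hdV dW hdW).subtype)
    (fun x y h1 h2 => eq_of_proj_eq_of_op_eq L e dV hdV dW hdW x y h1 h2)
    (fun z hz => exists_smul_of_proj_eq_one L e dV hdV hdV0 dW hdW hdW0 z hz)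
    { toFun := fun Φ : piSchwartzBruhat (Fp L) (Fin (n + n)) => (Φ : (Fin (n + n) → AdeleRing (𝓞 (Fp L)) (Fp L)) → ℂ) 0
      map_add' := fun _ _ => rfl
      map_smul' := fun _ _ => rfl }
    x y hπ hev hne

/-- **S3b (RATIONALITY OF `ι^𝔻` ON `H(L⁺)`)**: `ι^𝔻(H(L⁺)) ⊆ Sp_{L⁺}(𝕎^𝔻) = range ratSp` — the tree's
`UnitaryGroup.adelicToSymplectic_toAdelic_mem_range`. [cite: GelbartRogawski1991, §3.1 Prop. 3.1.1 p. 455 L1–2] -/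
theorem toSpD_mem_range_ratSp (h : HA L e dV hdV dW hdW) (hh : h ∈ ratH L e dV hdV dW hdW) :
    toSpD L e dV hdV dW hdW h ∈ (ratSp (Fp L) (gramDA L e dV hdV dW hdW) (isUnit_det_gramDA L e dV hdV hdV0 dW hdW hdW0)).range := by
  obtain ⟨γ, hγ⟩ := MonoidHom.mem_range.1 hh
  rw [← hγ]
  unfold ratSp
  exact UnitaryGroup.adelicToSymplectic_toAdelic_mem_range (Fp L) L (IsCMField.complexConj L) (n + n)
    (complexConj_imagUnit L) (imagUnit_ne_zero L) (imagUnit_mul_self L) (gramD_isSymm L e dV hdV dW hdW)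
    (isUnit_det_gramD L e dV hdV hdV0 dW hdW hdW0) (isUnit_det_gramDA L e dV hdV hdV0 dW hdW hdW0) rfl γ

/-! #### S3c: on RATIONAL parabolic elements the prescribed scalar is `1` (`χ|_{L^×} = 1`, product formula) -/

/-- the rational `det_Δ`: `det(γ₁₁ + γ₁₂)` over `L` for `γ ∈ H(L⁺)`.
[cite: GelbartRogawski1991, §3.1 Prop. 3.1.1 p. 455 L1–2] -/
def detDeltaRat (γ : UnitaryGroup.rational (Fp L) L (IsCMField.complexConj L) (n + n) (hermD L e dV hdV dW hdW)) : L :=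
  ((Matrix.reindex (e₂ (n := n)).symm (e₂ (n := n)).symm ((γ : GL (Fin (n + n)) L) : Matrix (Fin (n + n)) (Fin (n + n)) L)).toBlocks₁₁ +
    (Matrix.reindex (e₂ (n := n)).symm (e₂ (n := n)).symm ((γ : GL (Fin (n + n)) L) : Matrix (Fin (n + n)) (Fin (n + n)) L)).toBlocks₁₂).det

/-- `det_Δ (γ ⊗ 1) = det_Δ(γ) ⊗ 1`. [cite: GelbartRogawski1991, §3.1 Prop. 3.1.1 p. 455 L1–2] -/
theorem detDelta_toAdelic (γ : UnitaryGroup.rational (Fp L) L (IsCMField.complexConj L) (n + n) (hermD L e dV hdV dW hdW)) :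
    detDelta L e dV hdV dW hdW (UnitaryGroup.toAdelic (Fp L) L (IsCMField.complexConj L) (n + n) (hermD L e dV hdV dW hdW) γ) =
      algebraMap L (AdeleRing (𝓞 L) L) (detDeltaRat L e dV hdV dW hdW γ) := by
  unfold detDelta deltaBlock detDeltaRat blk
  rw [RingHom.map_det, RingHom.mapMatrix_apply, Matrix.map_add _ (map_add _)]
  rfl

/-- for RATIONAL `p ∈ H(L⁺)` with `det_Δ p` a unit, the idele `det_Δ p` is PRINCIPAL.
[cite: GelbartRogawski1991, §3.1 Prop. 3.1.1 p. 455 L1–2] -/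
theorem detDelta_unit_mem_principalIdeles (p : HA L e dV hdV dW hdW) (hp : p ∈ ratH L e dV hdV dW hdW)
    (hu : IsUnit (detDelta L e dV hdV dW hdW p)) : hu.unit ∈ principalIdeles L := by
  obtain ⟨γ, hγ⟩ := MonoidHom.mem_range.1 hp
  have hd : detDelta L e dV hdV dW hdW p = algebraMap L (AdeleRing (𝓞 L) L) (detDeltaRat L e dV hdV dW hdW γ) := by
    rw [← hγ]; exact detDelta_toAdelic L e dV hdV dW hdW γ
  have hne : detDeltaRat L e dV hdV dW hdW γ ≠ 0 := by
    intro h0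
    rw [h0, map_zero] at hd
    haveI : Nontrivial (AdeleRing (𝓞 L) L) := (AdeleRing.algebraMap_injective (𝓞 L) L).nontrivial
    exact not_isUnit_zero (hd ▸ hu)
  refine ⟨Units.mk0 _ hne, Units.ext ?_⟩
  simp [hd]

/-- **S3c**: on rational `P_Δ`-elements the prescribed scalar `χ(det_Δ p) |det_Δ p|^{1/2}` is `1`
(`HeckeCharacter.map_principal`, `ideleNorm_eq_one_of_mem_principalIdeles`).
[cite: GelbartRogawski1991, §3.1 Prop. 3.1.1 p. 455 L1–2] -/
theorem chiDet_mul_modDelta_eq_one_of_rational (χ : HeckeCharacter L) (p : HA L e dV hdV dW hdW)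
    (hp : p ∈ ratH L e dV hdV dW hdW) (hu : IsUnit (detDelta L e dV hdV dW hdW p)) :
    ((chiDet L e dV hdV dW hdW χ p : ℂˣ) : ℂ) * (modDelta L e dV hdV dW hdW p : ℂ) = 1 := by
  have hprin := detDelta_unit_mem_principalIdeles L e dV hdV dW hdW p hp hu
  unfold chiDet modDelta
  rw [dif_pos hu, dif_pos hu, HeckeCharacter.map_principal χ hprin, ideleNorm_eq_one_of_mem_principalIdeles hprin]
  simp

/-! #### S3b-val: `r_F^𝔻` of rational Levi ∕ unipotent generators has value-at-0 scalar `1` -/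

/-- the submonoid of `Mp(𝕎^𝔻)ᶜᵒⁿᵗ` of elements whose operator preserves the value at the origin.
[cite: GelbartRogawski1991, §3.1 Prop. 3.1.1 p. 455 L1–2] -/
def evalZeroFixing : Submonoid (MpD L e dV hdV dW hdW) where
  carrier := {q | ∀ Φ : piSchwartzBruhat (Fp L) (Fin (n + n)),
    opD L e dV hdV dW hdW q Φ 0 = (Φ : (Fin (n + n) → AdeleRing (𝓞 (Fp L)) (Fp L)) → ℂ) 0}
  one_mem' := fun Φ => by
    change (((adelicMpCont.omega (Fp L) (Fin (n + n)) (gramDA L e dV hdV dW hdW) 1 Φ :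
      piSchwartzBruhat (Fp L) (Fin (n + n))) : (Fin (n + n) → AdeleRing (𝓞 (Fp L)) (Fp L)) → ℂ) 0) = _
    rw [map_one, Module.End.one_apply]
  mul_mem' {q₁ q₂} h₁ h₂ Φ := by
    have e1 : (((adelicMpCont.omega (Fp L) (Fin (n + n)) (gramDA L e dV hdV dW hdW) q₁
        (adelicMpCont.omega (Fp L) (Fin (n + n)) (gramDA L e dV hdV dW hdW) q₂ Φ) :
          piSchwartzBruhat (Fp L) (Fin (n + n))) : (Fin (n + n) → AdeleRing (𝓞 (Fp L)) (Fp L)) → ℂ) 0) =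
        (((adelicMpCont.omega (Fp L) (Fin (n + n)) (gramDA L e dV hdV dW hdW) q₂ Φ :
          piSchwartzBruhat (Fp L) (Fin (n + n))) : (Fin (n + n) → AdeleRing (𝓞 (Fp L)) (Fp L)) → ℂ) 0) := h₁ _
    have e2 : (((adelicMpCont.omega (Fp L) (Fin (n + n)) (gramDA L e dV hdV dW hdW) q₂ Φ :
          piSchwartzBruhat (Fp L) (Fin (n + n))) : (Fin (n + n) → AdeleRing (𝓞 (Fp L)) (Fp L)) → ℂ) 0) =
        (Φ : (Fin (n + n) → AdeleRing (𝓞 (Fp L)) (Fp L)) → ℂ) 0 := h₂ Φ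
    change (((adelicMpCont.omega (Fp L) (Fin (n + n)) (gramDA L e dV hdV dW hdW) (q₁ * q₂) Φ :
      piSchwartzBruhat (Fp L) (Fin (n + n))) : (Fin (n + n) → AdeleRing (𝓞 (Fp L)) (Fp L)) → ℂ) 0) = _
    rw [map_mul, Module.End.mul_apply, e1, e2]

include hdV0 hdW0 in
/-- `r_F^𝔻(m(γ))` (`Φ ↦ Φ ∘ γ⁻¹`, `coe_ratThetaLiftCont_levi` + `coe_toOp_leviPair`) preserves the value at `0`.
[cite: GelbartRogawski1991, §3.1 Prop. 3.1.1 p. 455 L1–2] -/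
theorem rFD_levi_mem_evalZeroFixing (γ : GL (Fin (n + n)) (Fp L)) :
    rFD L e dV hdV hdV0 dW hdW hdW0 (SymplecticMatrix.levi γ) ∈ evalZeroFixing L e dV hdV dW hdW := by
  intro Φ
  have h1 := coe_ratThetaLiftCont_levi (Fp L) (gramDA L e dV hdV dW hdW) (isUnit_det_gramDA L e dV hdV hdV0 dW hdW hdW0) γ
  have h2 := coe_toOp_leviPair (Fp L) (gramDA L e dV hdV dW hdW) (isUnit_det_gramDA L e dV hdV hdV0 dW hdW hdW0)
    (ratGL (Fp L) γ) Φ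
  rw [← h1] at h2
  change ((MpPsi.toOp (adelicSchrodinger (Fp L) (Fin (n + n)) (gramDA L e dV hdV dW hdW))
      (rFD L e dV hdV hdV0 dW hdW hdW0 (SymplecticMatrix.levi γ) : adelicMp (Fp L) (Fin (n + n)) (gramDA L e dV hdV dW hdW)) Φ :
        piSchwartzBruhat (Fp L) (Fin (n + n))) : (Fin (n + n) → AdeleRing (𝓞 (Fp L)) (Fp L)) → ℂ) 0 = _
  rw [h2, twist_apply, Matrix.zero_vecMul]

include hdV0 hdW0 in
/-- `r_F^𝔻(v(σ))` (multiplication by `ψ(q_{−σ/2})`, `coe_ratThetaLiftCont_low` + `coe_toOp_unipPair`) preserves the value at `0`.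
[cite: GelbartRogawski1991, §3.1 Prop. 3.1.1 p. 455 L1–2] -/
theorem rFD_low_mem_evalZeroFixing (σ : Matrix (Fin (n + n)) (Fin (n + n)) (Fp L)) (hσ : σ.IsSymm) :
    rFD L e dV hdV hdV0 dW hdW hdW0 (SymplecticMatrix.low σ hσ) ∈ evalZeroFixing L e dV hdV dW hdW := by
  intro Φ
  have h1 := coe_ratThetaLiftCont_low (Fp L) (gramDA L e dV hdV dW hdW) (isUnit_det_gramDA L e dV hdV hdV0 dW hdW hdW0) σ hσ
  have h2 := coe_toOp_unipPair (Fp L) (gramDA L e dV hdV dW hdW) (isUnit_det_gramDA L e dV hdV hdV0 dW hdW hdW0)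
    (ratMatrix (Fp L) σ) (hσ.map _) Φ
  rw [← h1] at h2
  change ((MpPsi.toOp (adelicSchrodinger (Fp L) (Fin (n + n)) (gramDA L e dV hdV dW hdW))
      (rFD L e dV hdV hdV0 dW hdW hdW0 (SymplecticMatrix.low σ hσ) : adelicMp (Fp L) (Fin (n + n)) (gramDA L e dV hdV dW hdW)) Φ :
        piSchwartzBruhat (Fp L) (Fin (n + n))) : (Fin (n + n) → AdeleRing (𝓞 (Fp L)) (Fp L)) → ℂ) 0 = _
  rw [h2, chirp_apply, sdChar_apply, Matrix.zero_vecMul, dotProduct_zero, AddChar.map_zero_eq_one, Circle.coe_one, one_mul]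

include hdV0 hdW0 in
/-- **S3b-val**: `r_F^𝔻` of every element of the submonoid generated by rational Levi and unipotent generators (in particular of the
rational standard Siegel parabolic, once decomposed) has value-at-0 scalar `1`.
[cite: GelbartRogawski1991, §3.1 Prop. 3.1.1 p. 455 L1–2] -/
theorem rFD_mem_evalZeroFixing_of_mem_closure {P : Matrix.symplecticGroup (Fin (n + n)) (Fp L)}
    (hP : P ∈ Submonoid.closure ((Set.range (SymplecticMatrix.levi (l := Fin (n + n)) (R := Fp L))) ∪
      {x | ∃ σ hσ, x = SymplecticMatrix.low (l := Fin (n + n)) (R := Fp L) σ hσ})) :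
    rFD L e dV hdV hdV0 dW hdW hdW0 P ∈ evalZeroFixing L e dV hdV dW hdW := by
  rw [← Submonoid.mem_comap]
  refine Submonoid.closure_le.2 ?_ hP
  rintro x (⟨γ, rfl⟩ | ⟨σ, hσ, rfl⟩)
  · exact rFD_levi_mem_evalZeroFixing L e dV hdV hdV0 dW hdW hdW0 γ
  · exact rFD_low_mem_evalZeroFixing L e dV hdV hdV0 dW hdW hdW0 σ hσ


/-! ### Build-lane note (ops-buildfix G11b-3 recipe, LEDGER B13-1, 2026-08-21)
`lean -o` (the hub build lane, never `lean`/the gate check) runs Lean 4.32's library-suggestion indexers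
(`Lean.LibrarySuggestions.SymbolFrequency` / `SineQuaNon`, from their `exportEntriesFn`) over the statement of
every local theorem that is not a denied premise; on this family's statements (very large dependent binder
telescopes through the theta-kernel / dual-pair data) that fold runs for tens of minutes to hours and the build
lane kills the job (incident G11b-3, run/shared/lean/ops/buildfix/G11b-3-DOSSIER.md). `isDeniedPremise` skips
`[implicit_reducible]` constants before any fold, and a reducibility status on a *theorem* is inert (Meta never
unfolds `thmInfo`; the kernel ignores the attribute), so the public theorems of this file are tagged
`[implicit_reducible]` purely to keep them out of that index. Only other effect: they are not offered by
`+suggestions` premise selectors. No statement or proof is changed; superseded if the operator lands a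
deny-list form (`HarnessLib.PremiseIndex`). -/
set_option allowUnsafeReducibility true in
attribute [implicit_reducible]
  S2_ratH_normalClosure_siegel central_of_scalar_abstract exists_smul_of_proj_eq_one
  S3a_central_of_proj_eq_one pinned_abstract eq_of_proj_eq_of_evalZero_eq toSpD_mem_range_ratSp
  detDelta_toAdelic detDelta_unit_mem_principalIdeles chiDet_mul_modDelta_eq_one_of_rational
  rFD_levi_mem_evalZeroFixing rFD_low_mem_evalZeroFixing rFD_mem_evalZeroFixing_of_mem_closure

end Literature.NumberTheory.GelbartRogawski1991.GRConstruction
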